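import Summits.QuantumFields.Balaban3D.Proofs.FirstStepThresholds
import Summits.QuantumFields.Balaban3D.Proofs.Thresholds

/-!
# `Summit.QuantumFields.Balaban3D.Proofs.FirstStepGamma` — the first-step coupling threshold `γ_A` EXPORTED BY NAME for the
# lane's `γ₀ := Constants.gammaMin [γ_A, γ₄₆, γ₇₁, …]` (rulings R-EPS0′ / R-CONST; PLAN §0.5 lists «γ_12, γ_16 (p4)» — they are
# ONE threshold, this file's `gammaA`) — lane `pub-balaban3d`, seat p4

HONEST FRAMING (lane PLAN.md §0, binding): see `…Proofs.SectAFirstStep`.  Print fixes NO number for «g₀ sufficiently small»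
(pp. 258–259); `γ_A` is the lane's CHOICE (seat p4's σ-threshold `FirstStepThresholds.sigmaA` pushed through seat p2's
`Thresholds.gammaOf`, which inverts `g·p(g) ≤ σ` on `0 < g ≤ 1`).

WHAT THIS FILE PROVIDES (no `sorry`, axioms standard; real arithmetic only): `gammaA L B₃ a₁ b₀ p₀ := gammaOf b₀ p₀ (sigmaA L B₃ a₁)`,
`gammaA_pos_le` (`0 < γ_A ≤ 1`), and **`firstStep_smallness_of_le_gammaA`**: for `0 < g₀ ≤ γ_A` ALL FOUR first-step smallness
clauses hold at once — (12) p. 258 L34 «2L²g₀p(g₀) ≤ a₁» (= `γ_12`), (13) p. 259 L8–11 Lemma 1 of [6] (`2L²B₃g₀p(g₀) ≤ 1/24`),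
(13) p. 259 L11–12 the enlargement (`8·3²L²B₃g₀p(g₀) ≤ 1/4`), (16) p. 259 L33–37 via [4] (161) (`2L·16·3²L²B₃g₀p(g₀) ≤ ½`, = `γ_16`).
So p3's list carries ONE entry `γ_A` for this seat (not `γ_12`, `γ_16` separately); its premise `g_k ≤ γ₀ ≤ γ_A` comes from
`ScalesArithmetic.gk_le_gamma0_of_eps0Of` + `Constants.gammaMin_le`.
-/

namespace Summit.QuantumFields.Balaban3D.Proofs.FirstStepGamma

open Literature.MathematicalPhysics.QuantumFieldTheory.Balaban1983to89
open Summit.QuantumFields.Balaban3D.Proofs.FirstStepThresholds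
open Summit.QuantumFields.Balaban3D.Proofs.Thresholds (gammaOf gammaOf_pos_le gammaOf_spec)

/-- **`γ_A`**, the Sect. A coupling threshold of «g₀ sufficiently small» (pp. 258–259): `γ_A = γ(σ_A) = min 1 (σ_A/(b₀Q₀(p₀)))²`
with `σ_A = min (a₁/(2L²)) (1/(576L³B₃))` (`FirstStepThresholds.sigmaA`) — a lane CHOICE. [cite: Balaban1985UV3, (12)–(13) pp.258–259] -/
noncomputable def gammaA (L : ℕ) (B₃ a₁ b₀ p₀ : ℝ) : ℝ := gammaOf b₀ p₀ (sigmaA L B₃ a₁)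

variable {L : ℕ} {B₃ a₁ b₀ p₀ g : ℝ}

/-- `0 < γ_A ≤ 1` for `L ≥ 1`, `B₃, a₁, b₀, p₀ > 0` (so `γ_A` is an admissible entry of `Constants.gammaMin`'s list: `gammaMin_pos`).
[folklore] -/
theorem gammaA_pos_le (hL : 1 ≤ L) (hB : 0 < B₃) (ha : 0 < a₁) (hb : 0 < b₀) (hp : 0 < p₀) :
    0 < gammaA L B₃ a₁ b₀ p₀ ∧ gammaA L B₃ a₁ b₀ p₀ ≤ 1 :=
  gammaOf_pos_le hb hp (sigmaA_pos hL hB ha)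

/-- `0 < g₀ ≤ γ_A ⇒ g₀p(g₀) ≤ σ_A` (seat p2's `Thresholds.gammaOf_spec`). [folklore] -/
theorem gp_le_sigmaA (hL : 1 ≤ L) (hB : 0 < B₃) (ha : 0 < a₁) (hb : 0 < b₀) (hp : 0 < p₀) (hg : 0 < g)
    (hgγ : g ≤ gammaA L B₃ a₁ b₀ p₀) : g * B10.pFun b₀ p₀ g ≤ sigmaA L B₃ a₁ :=
  gammaOf_spec hb hp (sigmaA_pos hL hB ha).le hg hgγ

/-- **All first-step smallness clauses from `g₀ ≤ γ_A`** (the «g₀ sufficiently small» of Sect. A, pp. 258–259, made explicit):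
for `0 < g₀ ≤ γ_A`, with `t = g₀p(g₀)` — (12) `2L²t ≤ a₁`; (13)/Lemma 1 [6] `2L²B₃t ≤ 1/24`; (13)/enlargement `8·3²L²B₃t ≤ 1/4`;
(16)/[4] (161) `2L·(16·3²L²B₃t) ≤ ½`.  These are exactly the hypotheses consumed by LQB `B10Eq13RegularityClaims.claim259_d3`,
`B10Eq13Enlargement.region_subset_enlarged_selfAdjoint` and this seat's `SectAEq16.eq16_of_eq14` side condition (ii).
[cite: Balaban1985UV3, (12)–(16) pp.258–259] -/
theorem firstStep_smallness_of_le_gammaA (hL : 1 ≤ L) (hB : 0 < B₃) (ha : 0 < a₁) (hb : 0 < b₀) (hp : 0 < p₀)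
    (hg : 0 < g) (hgγ : g ≤ gammaA L B₃ a₁ b₀ p₀) :
    2 * (L : ℝ) ^ 2 * (g * B10.pFun b₀ p₀ g) ≤ a₁ ∧
      2 * (L : ℝ) ^ 2 * B₃ * (g * B10.pFun b₀ p₀ g) ≤ 1 / 24 ∧
      8 * 3 ^ 2 * (L : ℝ) ^ 2 * B₃ * (g * B10.pFun b₀ p₀ g) ≤ 1 / 4 ∧
      2 * (L : ℝ) * (16 * 3 ^ 2 * (L : ℝ) ^ 2 * B₃ * (g * B10.pFun b₀ p₀ g)) ≤ 1 / 2 := by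
  have ht := gp_le_sigmaA hL hB ha hb hp hg hgγ
  exact ⟨eq12_smallness hL ht, lemma1_smallness hL hB ht, enlargement_smallness hL hB ht, eq16_smallness hL hB ht⟩

end Summit.QuantumFields.Balaban3D.Proofs.FirstStepGamma
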